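import Mathlib
import HarnessLib
import Summits.AtomisticToContinuum.Crystallization.Theorems.FrustratedLawDichotomySphericalPairCheckFccSqrt3
import Summits.AtomisticToContinuum.Crystallization.Theorems.FrustratedLawDichotomySphericalPairCheckFccSqrt2
import Summits.AtomisticToContinuum.Crystallization.Theorems.FrustratedLawDichotomySphericalPairCheckHcpSqrt3a
import Summits.AtomisticToContinuum.Crystallization.Theorems.FrustratedLawDichotomySphericalPairCheckHcpSqrt3b
import Summits.AtomisticToContinuum.Crystallization.Theorems.FrustratedLawDichotomySphericalPairCheckHcpSqrt2
import Summits.AtomisticToContinuum.Crystallization.Theorems.FrustratedLawDichotomyLinkCertOfCap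
import Summits.AtomisticToContinuum.Crystallization.Theorems.OverbindingBudgetTwoShellCover
import Summits.AtomisticToContinuum.Crystallization.Theorems.OverbindingBudgetTwoShellShape

/-!
# FrustratedLawDichotomy · ★ `capForcing_hundredth : CapForcing (1/100)` — the `P` slot, by certified numerics

The four Boolean data hypotheses of `…SphericalPairCheck.capForcing_hundredth_of_pairChecks` are
discharged by the five certified pair-target replays `…SphericalPairCheck{FccSqrt3, FccSqrt2, HcpSqrt3a,
HcpSqrt3b, HcpSqrt2}` (one `Rig.checkAllT` per orbit representative; the `fcc` cells serve both `fcc`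
representatives), whence

* `capForcing_hundredth : CapForcing (1/100)` — the residual spherical-code input `P` of the
  `FrustratedLawDichotomy` cut (`…TwoShellRigidityCut`), now a theorem;
* with `G` = `…LinkCertOfCap.linkCert_hundredth` already landed, slot 3 of the RDEF cone — BY NAME
  `OverbindingBudgetTwoShellShape.TwoShellShape (1/100) (3/50) (1/450)`, the input of
  `…TwoShellShape.rdef_of_ceg_shape_registered`, and its verbatim twin `…TwoShellSeam.TwoShellShapeV`
  (the two agree by `Iff.rfl`; co-importable since the `MuGSC` dedup, critic row 635) — is reduced to the
  two capped `M`-certificates alone: `twoShellShape_of_cappedCerts` / `twoShellShapeV_of_cappedCerts`;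
  the six-hypothesis form `twoShellShape_of_certs` (G and P as hypotheses) is recorded too.

decomp-a2c lens 3 (gen 32); residual item stmt-AtomisticToContinuum-31280.
-/

namespace Summit.AtomisticToContinuum.Crystallization.Theorems.FrustratedLawDichotomySphericalPairCheck

open Rig
open Literature.Geometry.DiscreteGeometry (fccKissingPattern hcpKissingPattern)
open FrustratedLawDichotomyTwoShellRigidityCut (CapForcing)
open OverbindingBudgetTwoShellSeam (TwoShellShapeV)
open OverbindingBudgetTwoShellShape (TwoShellShape)
open FrustratedLawDichotomyLinkCert (LinkCert)
open FrustratedLawDichotomyCappedCertBoth (CappedCertBoth)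
open OverbindingBudgetTwoShellCover (twoShellShapeV_of_certs)
open FrustratedLawDichotomyLinkCertOfCap (linkCert_hundredth)

/-- the fcc `√3` representative pairs pass the pair check (from the certified stream `Rig.fccSqrt3_checkAllT`). [lens-3 g32] -/
theorem fcc_sqrt3_pairChecks : pairChecks fccModel CSqrt3 fccRepsSqrt3 [fccPairCells] = true := by
  simp only [pairChecks, fccRepsSqrt3, fccSqrt3_checkAllT, Bool.true_and]

/-- the hcp `√3` representative pairs pass the pair check (from `Rig.hcpSqrt3a_checkAllT` / `Rig.hcpSqrt3b_checkAllT`). [lens-3 g32] -/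
theorem hcp_sqrt3_pairChecks :
    pairChecks hcpModel CSqrt3 hcpRepsSqrt3 [hcpSqrt3aCells, hcpSqrt3bCells] = true := by
  simp only [pairChecks, hcpRepsSqrt3, hcpSqrt3a_checkAllT, hcpSqrt3b_checkAllT, Bool.true_and]

/-- the fcc `√2` representative pairs pass the pair check (from `Rig.fccSqrt2_checkAllT`). [lens-3 g32] -/
theorem fcc_sqrt2_pairChecks : pairChecks fccModel CSqrt2 fccRepsSqrt2 [fccPairCells] = true := by
  simp only [pairChecks, fccRepsSqrt2, fccSqrt2_checkAllT, Bool.true_and]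

/-- the hcp `√2` representative pairs pass the pair check (from `Rig.hcpSqrt2_checkAllT`). [lens-3 g32] -/
theorem hcp_sqrt2_pairChecks : pairChecks hcpModel CSqrt2 hcpRepsSqrt2 [hcpSqrt2Cells] = true := by
  simp only [pairChecks, hcpRepsSqrt2, hcpSqrt2_checkAllT, Bool.true_and]

/-- ★ **`CapForcing (1/100)`** — the `P` half of the `FrustratedLawDichotomy` cut, by certified numerics. -/
theorem capForcing_hundredth : CapForcing (1 / 100) :=
  capForcing_hundredth_of_pairChecks fcc_sqrt3_pairChecks hcp_sqrt3_pairChecks fcc_sqrt2_pairChecks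
    hcp_sqrt2_pairChecks

/-- **Slot 3 of the RDEF cone from the two capped `M`-certificates alone** (`G` and `P` discharged:
`linkCert_hundredth`, `capForcing_hundredth`). -/
theorem twoShellShapeV_of_cappedCerts {η₁ η₂ : ℝ} (hη₁ : η₁ ≤ 3 / 50) (hη₂ : η₂ ≤ 3 / 50)
    (hf : CappedCertBoth (1 / 100) η₁ η₂ fccKissingPattern)
    (hh : CappedCertBoth (1 / 100) η₁ η₂ hcpKissingPattern) : TwoShellShapeV (1 / 100) (3 / 50) (1 / 450) :=
  twoShellShapeV_of_certs hη₁ hη₂ linkCert_hundredth capForcing_hundredth hf hh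

/-- **Slot 3 BY NAME** — `OverbindingBudgetTwoShellShape.TwoShellShape (1/100) (3/50) (1/450)` (the input of
`…TwoShellShape.rdef_of_ceg_shape_registered`) from the two capped `M`-certificates alone; the `V`-twin proof
is accepted at this type definitionally (`TwoShellShapeV ↔ TwoShellShape` is `Iff.rfl`). -/
theorem twoShellShape_of_cappedCerts {η₁ η₂ : ℝ} (hη₁ : η₁ ≤ 3 / 50) (hη₂ : η₂ ≤ 3 / 50)
    (hf : CappedCertBoth (1 / 100) η₁ η₂ fccKissingPattern)
    (hh : CappedCertBoth (1 / 100) η₁ η₂ hcpKissingPattern) : TwoShellShape (1 / 100) (3 / 50) (1 / 450) :=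
  twoShellShapeV_of_cappedCerts hη₁ hη₂ hf hh

/-- The six-certificate form of `…TwoShellCover.twoShellShapeV_of_certs` with the slot-3 statement BY NAME as
conclusion (`G`, `P` as hypotheses; discharge them with `linkCert_hundredth`, `capForcing_hundredth`). -/
theorem twoShellShape_of_certs {η₁ η₂ : ℝ} (hη₁ : η₁ ≤ 3 / 50) (hη₂ : η₂ ≤ 3 / 50) (hL : LinkCert (1 / 100))
    (hP : CapForcing (1 / 100)) (hf : CappedCertBoth (1 / 100) η₁ η₂ fccKissingPattern)
    (hh : CappedCertBoth (1 / 100) η₁ η₂ hcpKissingPattern) : TwoShellShape (1 / 100) (3 / 50) (1 / 450) :=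
  twoShellShapeV_of_certs hη₁ hη₂ hL hP hf hh

end Summit.AtomisticToContinuum.Crystallization.Theorems.FrustratedLawDichotomySphericalPairCheck
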